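import Mathlib
import Summits.KontsevichZagierPeriods.Zeta5Search.BrickLevelReduction
import Summits.KontsevichZagierPeriods.Zeta5Search.BrickCellsAllPrimes

/-!
# BrickHoleCellsAllPrimes — THEOREM 8's fact (K) «hole cells are `O(p^A)`» for the CENTRE-FREE brick kernel `(A,B,0)`
at EVERY prime, `p = 2` included: the compensated top valuation with the digit-0 carry, LEMMA 1 (ii) in exponent form,
and the negligibility of hole terms in a level reduction (cell `pub-zeta5`, seat ct-1 g42)

HONEST FRAMING: systematic search; no irrationality claim unless certified.  INSTRUMENT lemmas about the Laurent cells
`cell A B 0 n K s = c̃_{K,s}(n)`, the harmonic cell `cellZero A B 0 n K` and the top coefficient `cTop A B 0 n K` of the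
centre-free brick kernels; nothing about `ζ(5)`/`ζ(3)`; no `γ`/record statement; records in print UNMOVED; NOTHING IS
DISCHARGED (net named-fact debt 0).

WHY: a level induction at the prime `2` for the residual of `Zudilin2002.integrality` (ct-1 g41: `propositionH_inf`
minus `hp2` at `(6,1,0)`) splits the row `n = n₀ + 2N` into the poles of the digit block (`k ≡ n₀`) and the HOLES
(`n₀ < k mod 2`, i.e. `n` even and `k` odd).  The tree's `BrickHoleCells` / `BrickLevelReduction.hole_term_le` give
«hole cells are `O(p^A)`» for odd `p` only because `BrickHoleCells.padicValuation_cTop_le_choose` carries the centre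
factor `(n/2 − K)^ε`; for `ε = 0` the same proofs run at every prime (Kummer `BrickTopKummer.padicValuation_choose_add_le`,
Lucas at digit 0 `BrickHoleCells.one_le_padicValNat_choose_of_mod_lt`, `BrickCellValuation.cell_valuation`,
`BrickDigitStepDZero.hsum_valuation` are prime-free):

* `padicValuation_cTop_zero_le_choose` — LEMMA 1 (i): `v(c̃_{K,A}(n)) ≤ exp(−(A·v_p(C(n,K)) + B·σ^{(L)}_K))`, `K ≤ n < p^{L+1}`;
* `pow_mul_cell_zero_valuation`, `pow_mul_cellZero_zero_valuation` — LEMMA 1 (ii):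
  `v(p^e·c̃_{K,s}(n)) ≤ exp(L(A−s) − e − A·v_p(C(n,K)))`, `v(p^e·c̃⁰_K(n)) ≤ exp(LA − e − A·v_p(C(n,K)))` (`2B ≤ A`);
* **`holeCell_zero_le`, `holeCellZero_zero_le`** — fact (K): for a hole cell (`n % p < K % p`)
  `v(p^{L(A−s)}·c̃_{K,s}(n)) ≤ exp(−A)` and `v(p^{LA}·c̃⁰_K(n)) ≤ exp(−A)` — EVERY prime;
* **`hole_term_zero_le`, `hole_termZero_zero_le`** — for `k ≤ n < p^{L+2}`, `n % p < k % p`, `L + 1 ≤ A`, `g ∈ ℤ_(p)`: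
  `v(g·p^{(L+1)(A−s)}·c̃_{k,s}(n)) ≤ exp(−(L+1))`, the same for the harmonic cell (the tree's
  `BrickLevelReduction.hole_term_le` at `ε = 0` without `p ≠ 2`);
* `p = 2`: `holeCell_two_le` — on an even row `n` every ODD pole `K` has `v₂(2^{L(A−s)}c̃_{K,s}(n)) ≥ A`.

Theorems only (0 `def`); tree vocabulary; nothing restated (the odd-`p`, general-`ε` forms stay the tree's).
-/

namespace Summit.KontsevichZagierPeriods.Zeta5Search.BrickHoleCellsAllPrimes

open Finset Nat WithZero
open Summit.KontsevichZagierPeriods.Zeta5Search.BrickTopCoefficient (cTop)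
open Summit.KontsevichZagierPeriods.Zeta5Search.BrickLaurent (cell laurent)
open Summit.KontsevichZagierPeriods.Zeta5Search.BrickLaurentValuation (padicValuation_natCast)
open Summit.KontsevichZagierPeriods.Zeta5Search.BrickPartialFractions (cellZero)
open Summit.KontsevichZagierPeriods.Zeta5Search.BrickCellValuation (sigmaTop cell_valuation)
open Summit.KontsevichZagierPeriods.Zeta5Search.BrickTopKummer (padicValuation_choose_add_le)
open Summit.KontsevichZagierPeriods.Zeta5Search.BrickHarmonicBlocks (hsum)
open Summit.KontsevichZagierPeriods.Zeta5Search.BrickDigitStepDZero (cellZero_eq hsum_valuation)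
open Summit.KontsevichZagierPeriods.Zeta5Search.BrickResidueLawMain (level_hsum_integral)
open Summit.KontsevichZagierPeriods.Zeta5Search.BrickHoleCells (one_le_padicValNat_choose_of_mod_lt)
open Literature.NumberTheory.LFunctions (padicValuation_natCast_le_one)

noncomputable section

variable {p : ℕ} [Fact p.Prime]

/-- **LEMMA 1 (i) for the centre-free kernel at EVERY prime**: for `K ≤ n < p^{L+1}`,
`v(cTop A B 0 n K) ≤ exp(−(A·v_p(C(n,K)) + B·σ^{(L)}_K(n)))`. -/
theorem padicValuation_cTop_zero_le_choose (A B : ℕ) {L n K : ℕ} (hn : n < p ^ (L + 1)) (hK : K ≤ n) :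
    Rat.padicValuation p (cTop A B 0 n K) ≤
      exp (-((A * padicValNat p (n.choose K) + B * sigmaTop p L n K : ℕ) : ℤ)) := by
  have h1 : Rat.padicValuation p ((-1 : ℚ) ^ (n * B + K * A)) = 1 := by
    rw [map_pow, Valuation.map_neg, map_one, one_pow]
  have h3 : Rat.padicValuation p ((n.choose K : ℚ) ^ A) ≤ exp (-((A * padicValNat p (n.choose K) : ℕ) : ℤ)) := by
    rw [map_pow, padicValuation_natCast (Nat.choose_pos hK).ne', ← exp_nsmul, nsmul_eq_mul, exp_le_exp]
    push_cast
    linarith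
  have h4 : Rat.padicValuation p ((((n + K).choose K : ℚ) * ((2 * n - K).choose n : ℚ)) ^ B) ≤
      exp (-((B * sigmaTop p L n K : ℕ) : ℤ)) := by
    have key : exp (-((B * sigmaTop p L n K : ℕ) : ℤ)) =
        (exp (-((if p ^ (L + 1) ≤ n + K then 1 else 0 : ℕ) : ℤ)) *
          exp (-((if p ^ (L + 1) ≤ 2 * n - K then 1 else 0 : ℕ) : ℤ))) ^ B := by
      rw [← exp_add, ← exp_nsmul, nsmul_eq_mul, sigmaTop]; congr 1; push_cast; ring
    rw [map_pow, map_mul, key]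
    refine pow_le_pow_left' (mul_le_mul' (padicValuation_choose_add_le hn (by omega)) ?_) B
    have h := padicValuation_choose_add_le (p := p) (L := L) (n := n - K) (k := n) (by omega) hn
    rwa [show n - K + n = 2 * n - K by omega] at h
  unfold cTop
  rw [map_mul, map_mul, map_mul, h1, one_mul, pow_zero, map_one, one_mul]
  calc _ ≤ exp (-((A * padicValNat p (n.choose K) : ℕ) : ℤ)) * exp (-((B * sigmaTop p L n K : ℕ) : ℤ)) :=
        mul_le_mul' h3 h4
    _ = _ := by rw [← exp_add]; congr 1; push_cast; ring

/-- **LEMMA 1 (ii), centre-free kernel, every prime** (`2B ≤ A`, `K ≤ n < p^{L+1}`):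
`v(p^e·c̃_{K,s}(n)) ≤ exp(L(A−s) − e − A·v_p(C(n,K)))`. -/
theorem pow_mul_cell_zero_valuation {A B : ℕ} (hAB : 2 * B ≤ A) {L n K : ℕ} (hn : n < p ^ (L + 1)) (hK : K ≤ n)
    (e s : ℕ) :
    Rat.padicValuation p ((p : ℚ) ^ e * cell A B 0 n K s) ≤
      exp ((L : ℤ) * (A - s : ℕ) - e - ((A * padicValNat p (n.choose K) : ℕ) : ℤ)) := by
  have hcell := cell_valuation (p := p) hAB hn hK (Or.inr rfl) s
  have htop := padicValuation_cTop_zero_le_choose (p := p) A B hn hK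
  rw [map_mul, map_pow, Rat.padicValuation_self, ← exp_nsmul]
  refine (mul_le_mul' le_rfl (hcell.trans (mul_le_mul' htop le_rfl))).trans ?_
  rw [← exp_add, ← exp_add, exp_le_exp, nsmul_eq_mul]
  push_cast
  linarith

/-- **LEMMA 1 (ii) for the harmonic cell, centre-free kernel, every prime**:
`v(p^e·c̃⁰_K(n)) ≤ exp(LA − e − A·v_p(C(n,K)))` (`v(H_K^{(s)}) ≥ −Ls` for `K < p^{L+1}`). -/
theorem pow_mul_cellZero_zero_valuation {A B : ℕ} (hAB : 2 * B ≤ A) {L n K : ℕ} (hn : n < p ^ (L + 1))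
    (hK : K ≤ n) (e : ℕ) :
    Rat.padicValuation p ((p : ℚ) ^ e * cellZero A B 0 n K) ≤
      exp ((L : ℤ) * A - e - ((A * padicValNat p (n.choose K) : ℕ) : ℤ)) := by
  have hKlt : K < p ^ (L + 1) := lt_of_le_of_lt hK hn
  rw [cellZero_eq, mul_neg, Valuation.map_neg, Finset.mul_sum]
  refine Valuation.map_sum_le _ fun s hs => ?_
  have hs' := mem_Icc.1 hs
  rw [← mul_assoc, map_mul]
  refine (mul_le_mul' (pow_mul_cell_zero_valuation hAB hn hK e s) (hsum_valuation hKlt s)).trans ?_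
  rw [← exp_add, exp_le_exp, Nat.cast_sub hs'.2]
  linarith

/-- **Fact (K), cells `s ≥ 1`, every prime**: a hole cell of the centre-free kernel (`n % p < K % p`, `K ≤ n < p^{L+1}`,
`2B ≤ A`) has `v(p^{L(A−s)}·c̃_{K,s}(n)) ≤ exp(−A)`. -/
theorem holeCell_zero_le {A B : ℕ} (hAB : 2 * B ≤ A) {L n K : ℕ} (hn : n < p ^ (L + 1)) (hK : K ≤ n)
    (h : n % p < K % p) (s : ℕ) :
    Rat.padicValuation p ((p : ℚ) ^ (L * (A - s)) * cell A B 0 n K s) ≤ exp (-(A : ℤ)) := by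
  have hv : (1 : ℤ) ≤ padicValNat p (n.choose K) := by exact_mod_cast one_le_padicValNat_choose_of_mod_lt hK h
  refine (pow_mul_cell_zero_valuation hAB hn hK (L * (A - s)) s).trans (exp_le_exp.2 ?_)
  simp only [Nat.cast_mul]
  nlinarith [mul_nonneg (Int.natCast_nonneg A) (sub_nonneg.2 hv)]

/-- **Fact (K), harmonic cell, every prime**: a hole cell has `v(p^{LA}·c̃⁰_K(n)) ≤ exp(−A)`. -/
theorem holeCellZero_zero_le {A B : ℕ} (hAB : 2 * B ≤ A) {L n K : ℕ} (hn : n < p ^ (L + 1)) (hK : K ≤ n)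
    (h : n % p < K % p) :
    Rat.padicValuation p ((p : ℚ) ^ (L * A) * cellZero A B 0 n K) ≤ exp (-(A : ℤ)) := by
  have hv : (1 : ℤ) ≤ padicValNat p (n.choose K) := by exact_mod_cast one_le_padicValNat_choose_of_mod_lt hK h
  refine (pow_mul_cellZero_zero_valuation hAB hn hK (L * A)).trans (exp_le_exp.2 ?_)
  simp only [Nat.cast_mul]
  nlinarith [mul_nonneg (Int.natCast_nonneg A) (sub_nonneg.2 hv)]

/-- **Hole terms are negligible in a level reduction — every prime** (the tree's `BrickLevelReduction.hole_term_le` at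
`ε = 0` without `p ≠ 2`): for `k ≤ n < p^{L+2}`, `n % p < k % p`, `L + 1 ≤ A`, `g ∈ ℤ_(p)`:
`v(g·p^{(L+1)(A−s)}·c̃_{k,s}(n)) ≤ exp(−(L+1))`. -/
theorem hole_term_zero_le {A B : ℕ} (hAB : 2 * B ≤ A) {L n : ℕ} (hn : n < p ^ (L + 1 + 1)) (hLA : L + 1 ≤ A)
    {k : ℕ} (hk : k ≤ n) (hhole : n % p < k % p) {g : ℚ} (hg : Rat.padicValuation p g ≤ 1) (s : ℕ) :
    Rat.padicValuation p (g * ((p : ℚ) ^ ((L + 1) * (A - s)) * cell A B 0 n k s)) ≤ exp (-((L : ℤ) + 1)) := by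
  have hv : (1 : ℤ) ≤ padicValNat p (n.choose k) := by exact_mod_cast one_le_padicValNat_choose_of_mod_lt hk hhole
  have hcell : Rat.padicValuation p ((p : ℚ) ^ ((L + 1) * (A - s)) * cell A B 0 n k s) ≤ exp (-(A : ℤ)) := by
    refine (pow_mul_cell_zero_valuation hAB hn hk ((L + 1) * (A - s)) s).trans (exp_le_exp.2 ?_)
    simp only [Nat.cast_mul]
    nlinarith [mul_nonneg (Int.natCast_nonneg A) (sub_nonneg.2 hv)]
  rw [map_mul]
  calc _ ≤ 1 * exp (-(A : ℤ)) := mul_le_mul' hg hcell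
    _ ≤ _ := by rw [one_mul, exp_le_exp]; omega

/-- **Hole harmonic terms are negligible — every prime**: the same for `g·p^{(L+1)A}·c̃⁰_k(n)`. -/
theorem hole_termZero_zero_le {A B : ℕ} (hAB : 2 * B ≤ A) {L n : ℕ} (hn : n < p ^ (L + 1 + 1)) (hLA : L + 1 ≤ A)
    {k : ℕ} (hk : k ≤ n) (hhole : n % p < k % p) {g : ℚ} (hg : Rat.padicValuation p g ≤ 1) :
    Rat.padicValuation p (g * ((p : ℚ) ^ ((L + 1) * A) * cellZero A B 0 n k)) ≤ exp (-((L : ℤ) + 1)) := by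
  have hklt : k < p ^ (L + 1 + 1) := lt_of_le_of_lt hk hn
  rw [cellZero_eq, mul_neg, mul_neg, Valuation.map_neg, Finset.mul_sum, Finset.mul_sum]
  refine Valuation.map_sum_le _ fun s hs => ?_
  have hs' := mem_Icc.1 hs
  rw [show g * ((p : ℚ) ^ ((L + 1) * A) * (cell A B 0 n k s * hsum s k)) =
      (g * ((p : ℚ) ^ ((L + 1) * (A - s)) * cell A B 0 n k s)) * ((p : ℚ) ^ ((L + 1) * s) * hsum s k) by
    rw [show (L + 1) * A = (L + 1) * (A - s) + (L + 1) * s by rw [← mul_add, Nat.sub_add_cancel hs'.2], pow_add]; ring,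
    map_mul]
  calc _ ≤ exp (-((L : ℤ) + 1)) * 1 :=
        mul_le_mul' (hole_term_zero_le hAB hn hLA hk hhole hg s) (level_hsum_integral hklt s)
    _ = _ := mul_one _

/-- `p = 2`: **on an even row every odd pole of the centre-free kernel is `O(2^A)`** — for `n` even, `K` odd,
`K ≤ n < 2^{L+1}`, `2B ≤ A`: `v₂(2^{L(A−s)}·c̃_{K,s}(n)) ≤ exp(−A)`. -/
theorem holeCell_two_le {A B : ℕ} (hAB : 2 * B ≤ A) {L n K : ℕ} (hn : n < 2 ^ (L + 1)) (hK : K ≤ n)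
    (heven : n % 2 = 0) (hodd : K % 2 = 1) (s : ℕ) :
    @Rat.padicValuation 2 ⟨Nat.prime_two⟩ ((2 : ℚ) ^ (L * (A - s)) * cell A B 0 n K s) ≤ exp (-(A : ℤ)) :=
  @holeCell_zero_le 2 ⟨Nat.prime_two⟩ A B hAB L n K hn hK (by omega) s

end

end Summit.KontsevichZagierPeriods.Zeta5Search.BrickHoleCellsAllPrimes
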